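import Summits.AnomalousDissipation.AnomalousDissipation.Theorems.MomentParityDefs

/-!
# Route MomentParity · `GalerkinEnsembleRealization` — the trajectory space: compactness, shift

Basic topology of the trajectory space `pathSpace R L` of `MomentParityDefs`
(stmt-AnomalousDissipation-11466): it is a closed subset of the compact product of closed balls
of radius `|R|`, hence compact (and metrizable, second countable: the ambient path type is a
countable product of Euclidean spaces); the unit shift is continuous and preserves it.
-/

noncomputable section

set_option linter.dupNamespace false

open MeasureTheory Set Filter Topology Function Metric
open scoped BigOperators

namespace Summit.AnomalousDissipation.AnomalousDissipation.Theorems.MomentParity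

open Literature.Analysis.FunctionSpaces Literature.Analysis.FunctionSpaces.Torus Literature.Analysis.FluidPDE

variable {d : Type*} [Fintype d] {R : ℝ} {L : (d → ℤ) → ℝ}

/-! ### Pointwise bound and compactness -/

/-- Every value of a path of `𝒦(R, L)` has norm at most `|R|` (the energy clause with the
one-element set of frequencies). -/
theorem norm_apply_le_of_mem_pathSpace {ω : Path d} (hω : ω ∈ pathSpace R L) (p : ℚ × (d → ℤ)) :
    ‖ω p‖ ≤ |R| := by
  obtain ⟨q, k⟩ := p
  have h := hω.2.1 q {k}
  rw [Finset.sum_singleton] at h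
  have h' : ‖ω (q, k)‖ ^ 2 ≤ |R| ^ 2 := by rwa [sq_abs]
  exact le_abs_self _ |>.trans (abs_le_of_sq_le_sq h' (abs_nonneg R))

/-- `𝒦(R, L)` lies in the product of the closed balls of radius `|R|`. -/
theorem pathSpace_subset_pi (R : ℝ) (L : (d → ℤ) → ℝ) :
    pathSpace (d := d) R L ⊆ Set.pi univ fun _ => closedBall 0 |R| := fun ω hω =>
  mem_univ_pi.2 fun p' => by
    rw [mem_closedBall, dist_zero_right]; exact norm_apply_le_of_mem_pathSpace hω p'

/-- **The trajectory space is closed** (every clause is a closed condition on finitely many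
coordinates). -/
theorem isClosed_pathSpace (R : ℝ) (L : (d → ℤ) → ℝ) : IsClosed (pathSpace (d := d) R L) := by
  have hev : ∀ p : ℚ × (d → ℤ), Continuous fun ω : Path d => ω p := fun p => continuous_apply p
  have h1 : IsClosed {ω : Path d | ∀ q k, ω (q, k) = ω (max q 0, k)} := by
    simp only [setOf_forall]
    exact isClosed_iInter fun q => isClosed_iInter fun k => isClosed_eq (hev _) (hev _)
  have h2 : IsClosed {ω : Path d | ∀ q (T : Finset (d → ℤ)), ∑ k ∈ T, ‖ω (q, k)‖ ^ 2 ≤ R ^ 2} := by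
    simp only [setOf_forall]
    refine isClosed_iInter fun q => isClosed_iInter fun T => isClosed_le ?_ continuous_const
    exact continuous_finsetSum _ fun k _ => ((hev _).norm).pow 2
  have h3 : IsClosed {ω : Path d | ∀ q q' k, 0 ≤ q → 0 ≤ q' →
      ‖ω (q, k) - ω (q', k)‖ ≤ L k * |(q : ℝ) - q'|} := by
    simp only [setOf_forall]
    refine isClosed_iInter fun q => isClosed_iInter fun q' => isClosed_iInter fun k =>
      isClosed_iInter fun _ => isClosed_iInter fun _ => isClosed_le ((hev _).sub (hev _)).norm
        continuous_const
  have h4 : IsClosed {ω : Path d | ∀ q, IsConjSymm fun k => ω (q, k)} := by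
    simp only [setOf_forall, IsConjSymm]
    refine isClosed_iInter fun q => isClosed_iInter fun k => isClosed_eq (hev _) ?_
    exact (EuclideanSpace.conjVecL (ι := d)).continuous.comp (hev (q, k))
  have h5 : IsClosed {ω : Path d | ∀ q k, ∑ j, (k j : ℂ) * ω (q, k) j = 0} := by
    simp only [setOf_forall]
    refine isClosed_iInter fun q => isClosed_iInter fun k => isClosed_eq ?_ continuous_const
    exact continuous_finsetSum _ fun j _ => continuous_const.mul
      ((EuclideanSpace.proj j).continuous.comp (hev _))
  have heq : pathSpace (d := d) R L = {ω : Path d | ∀ q k, ω (q, k) = ω (max q 0, k)} ∩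
      {ω | ∀ q (T : Finset (d → ℤ)), ∑ k ∈ T, ‖ω (q, k)‖ ^ 2 ≤ R ^ 2} ∩
      {ω | ∀ q q' k, 0 ≤ q → 0 ≤ q' → ‖ω (q, k) - ω (q', k)‖ ≤ L k * |(q : ℝ) - q'|} ∩
      {ω | ∀ q, IsConjSymm fun k => ω (q, k)} ∩
      {ω | ∀ q k, ∑ j, (k j : ℂ) * ω (q, k) j = 0} := by
    ext ω
    simp only [pathSpace, mem_setOf_eq, mem_inter_iff]
    tauto
  rw [heq]
  exact (((h1.inter h2).inter h3).inter h4).inter h5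

/-- **The trajectory space is compact** (closed in the compact product of closed balls,
Tychonoff). -/
theorem isCompact_pathSpace (R : ℝ) (L : (d → ℤ) → ℝ) : IsCompact (pathSpace (d := d) R L) :=
  (isCompact_univ_pi fun _ => isCompact_closedBall _ _).of_isClosed_subset
    (isClosed_pathSpace R L) (pathSpace_subset_pi R L)

/-- The trajectory space as a compact space. -/
theorem compactSpace_pathSpace (R : ℝ) (L : (d → ℤ) → ℝ) : CompactSpace ↥(pathSpace (d := d) R L) :=
  isCompact_iff_compactSpace.1 (isCompact_pathSpace R L)

/-- The zero path belongs to every trajectory space with nonnegative Lipschitz constants. -/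
theorem zero_mem_pathSpace (R : ℝ) {L : (d → ℤ) → ℝ} (hL : ∀ k, 0 ≤ L k) :
    (0 : Path d) ∈ pathSpace R L := by
  refine ⟨fun q k => rfl, fun q T => ?_, fun q q' k _ _ => ?_, fun q k => ?_, fun q k => ?_⟩
  · simp only [Pi.zero_apply, norm_zero, ne_eq, OfNat.ofNat_ne_zero, not_false_eq_true, zero_pow,
      Finset.sum_const_zero]
    positivity
  · simp only [Pi.zero_apply, sub_zero, norm_zero]
    exact mul_nonneg (hL k) (abs_nonneg _)
  · simp only [Pi.zero_apply]
    ext i; simp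
  · simp

/-! ### The shift -/

/-- The shift is continuous (each coordinate of `θω` is a coordinate of `ω`). -/
theorem continuous_pathShift : Continuous (pathShift (d := d)) :=
  continuous_pi fun _ => continuous_apply _

/-- **The shift preserves the trajectory space.** -/
theorem pathShift_mem {ω : Path d} (hω : ω ∈ pathSpace R L) : pathShift ω ∈ pathSpace R L := by
  obtain ⟨h0, hE, hLip, hsymm, htr⟩ := hω
  refine ⟨fun q k => ?_, fun q T => ?_, fun q q' k hq hq' => ?_, fun q => ?_, fun q k => ?_⟩
  · simp only [pathShift_apply]
    rw [max_eq_left (le_max_right q 0)]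
  · simp only [pathShift_apply]; exact hE _ T
  · simp only [pathShift_apply, max_eq_left hq, max_eq_left hq']
    refine (hLip (q + 1) (q' + 1) k (by linarith) (by linarith)).trans (le_of_eq ?_)
    congr 1
    push_cast; ring_nf
  · intro k
    simp only [pathShift_apply]
    exact hsymm _ k
  · exact htr _ k

/-- The restricted shift on `𝒦(R, L)`. -/
theorem pathShift_mapsTo (R : ℝ) (L : (d → ℤ) → ℝ) :
    ∀ ω ∈ pathSpace (d := d) R L, pathShift ω ∈ pathSpace R L := fun _ hω => pathShift_mem hω

/-- The restricted shift is continuous. -/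
theorem continuous_pathShiftOn (R : ℝ) (L : (d → ℤ) → ℝ) :
    Continuous (pathShiftOn (d := d) R L (pathShift_mapsTo R L)) :=
  (continuous_pathShift.comp continuous_subtype_val).subtype_mk _

/-- Iterates of the shift: `(θ^[n] ω)(q, k) = ω(q⁺ + n, k)` for paths reading negative times as `0`. -/
theorem pathShift_iterate_apply {ω : Path d} (h0 : ∀ q k, ω (q, k) = ω (max q 0, k)) (n : ℕ)
    (q : ℚ) (k : d → ℤ) : (pathShift^[n] ω) (q, k) = ω (max q 0 + n, k) := by
  induction n generalizing q with
  | zero => simpa using h0 q k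
  | succ n ih =>
    rw [iterate_succ_apply', pathShift_apply, ih]
    congr 1
    rw [max_eq_left (by positivity : (0:ℚ) ≤ max q 0 + 1)]
    push_cast; ring

end Summit.AnomalousDissipation.AnomalousDissipation.Theorems.MomentParity
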